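import Mathlib.Algebra.BigOperators.Finprod
import Literature.Probability.RandomPlanarGeometry.SelfAvoidingWalk
import HarnessLib

/-!
# BFACF plaquette dynamics on self-avoiding walks with fixed endpoints
# (Berg–Foerster 1981; Aragão de Carvalho–Caracciolo–Fröhlich 1983; Madras–Slade 1993, §9.6.1)

Topic `Literature/Probability/RandomPlanarGeometry`, namespace `…SAW` (definition item
`defn-SAW.bfacfGenerator`, for route `CriticalPhenomena/SAWStochasticQuantisation`, items
stmt-CriticalPhenomena-7764…7767, which inline the same prelude).

Carrier: `DomainSAW Ω δ u v` (`SelfAvoidingWalk.lean`): self-avoiding lattice paths of the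
discretised domain `Ω_δ ⊆ ℤ²` from `u` to `v`, with `length` and vertex list `walk.support`.

* `DomainSAW.BFACFAdj γ γ'` — the **BFACF elementary move** relation (Madras–Slade 1993, §9.6.1,
  Fig. 9.7–9.8; Berg–Foerster; Aragão de Carvalho–Caracciolo–Fröhlich): the vertex lists of `γ`
  and `γ'` agree outside one window, `support γ = p ++ y :: (s ++ z :: q)`,
  `support γ' = p ++ y :: (s' ++ z :: q)` with `s ≠ s'` and `|s| + |s'| = 2`: the cases
  `(|s|,|s'|) = (0,2), (2,0)` are the `Δ|γ| = ±2` moves (push out / push in a unit plaquette across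
  the edge `yz`), `(1,1)` is the corner flip; since both are nearest-neighbour paths the four
  vertices involved span a unit square. (This presentation by vertex windows EXCLUDES the
  non-BFACF reconnection with the same edge symmetric difference.)
* `bfacfGenerator x g γ = Σ_{γ' ~ γ} min(1, x^{|γ'|−|γ|}) (g γ' − g γ)` — the generator of the
  continuous-time **Metropolis BFACF chain at fugacity `x`** (every move attempted at rate `1`,
  accepted with probability `min(1, x^{Δ|γ|})`; symmetric proposal), a `finsum` (finite for
  bounded `Ω`, `δ > 0`).
* `bfacfCarreDuChamp x g γ = Σ_{γ' ~ γ} min(1, x^{|γ'|−|γ|}) (g γ' − g γ)²`.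
* API (proved): `BFACFAdj.symm`, `BFACFAdj.length_sub_length_mem` (`|γ'| − |γ| ∈ {−2, 0, 2}`),
  the pointwise DETAILED-BALANCE identity `bfacf_detailedBalance`
  (`x^{|γ|} min(1, x^{|γ'|−|γ|}) = min(x^{|γ|}, x^{|γ'|})`, symmetric in `γ, γ'` — whence
  reversibility of `x^{|γ|}`, in particular of `SAW.law` at `x = x_c`, Madras–Slade Lemma 9.6.1),
  `bfacfGenerator_const`, `bfacfCarreDuChamp_nonneg`.

Deliberately NOT here: the integrated identities `∫ L g d(x^{|·|}) = 0`, self-adjointness and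
`∫ g L g = −½ ∫ Γ g` (they are the route's items ExactStationarity etc., one `Finset.sum_comm` away
from `bfacf_detailedBalance` once `DomainSAW` is known finite), ergodicity questions of BFACF
(Madras–Slade §9.6.2–9.7), and the hexagonal-lattice analogue.

## References
* N. Madras, G. Slade, *The Self-Avoiding Walk*, Birkhäuser 1993, §9.6.1 (pp. 338–343),
  Lemma 9.6.1 [MadrasSlade1993].
* B. Berg, D. Foerster, Random paths and random surfaces on a digital computer, Phys. Lett. B 106
  (1981) 323–326.
* C. Aragão de Carvalho, S. Caracciolo, J. Fröhlich, Polymers and `g|φ|⁴` theory in four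
  dimensions, Nucl. Phys. B 215 (1983) 209–248 (doi:10.1016/0550-3213(83)90213-4).
-/

noncomputable section

open Literature.Probability.LatticeModels

namespace Literature.Probability.RandomPlanarGeometry.SAW

namespace DomainSAW

variable {Ω : Set ℂ} {δ : ℝ} {u v : Site 2}

/-- **BFACF adjacency** (one elementary plaquette move): the vertex lists agree outside a window
`y … z` in which `γ` passes through `s` and `γ'` through `s'`, `s ≠ s'`, `|s| + |s'| = 2`
(Madras–Slade 1993, §9.6.1, Fig. 9.7: `Δ|γ| = +2, −2` for `(|s|,|s'|) = (0,2), (2,0)`, the corner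
flip for `(1,1)`). [cite: MadrasSlade1993, §9.6.1 (Fig. 9.7–9.8, the BFACF elementary moves)] -/
def BFACFAdj (γ γ' : DomainSAW Ω δ u v) : Prop :=
  ∃ (p q s s' : List (Site 2)) (y z : Site 2),
    γ.walk.support = p ++ y :: (s ++ z :: q) ∧ γ'.walk.support = p ++ y :: (s' ++ z :: q) ∧
      s ≠ s' ∧ s.length + s'.length = 2

/-- BFACF adjacency is symmetric. [cite: MadrasSlade1993, §9.6.1] -/
theorem BFACFAdj.symm {γ γ' : DomainSAW Ω δ u v} (h : BFACFAdj γ γ') : BFACFAdj γ' γ := by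
  obtain ⟨p, q, s, s', y, z, hγ, hγ', hne, hlen⟩ := h
  exact ⟨p, q, s', s, y, z, hγ', hγ, hne.symm, by omega⟩

/-- A BFACF move changes the length by `−2`, `0` or `+2`. [cite: MadrasSlade1993, §9.6.1 (ΔN ∈ {−2, 0, +2})] -/
theorem BFACFAdj.length_sub_length_mem {γ γ' : DomainSAW Ω δ u v} (h : BFACFAdj γ γ') :
    (γ'.length : ℤ) - γ.length ∈ ({-2, 0, 2} : Set ℤ) := by
  obtain ⟨p, q, s, s', y, z, hγ, hγ', -, hlen⟩ := h
  have h1 : γ.walk.support.length = γ.length + 1 := γ.walk.length_support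
  have h2 : γ'.walk.support.length = γ'.length + 1 := γ'.walk.length_support
  rw [hγ] at h1
  rw [hγ'] at h2
  simp only [List.length_append, List.length_cons] at h1 h2
  simp only [Set.mem_insert_iff, Set.mem_singleton_iff]
  omega

end DomainSAW

variable {Ω : Set ℂ} {δ : ℝ} {u v : Site 2}

open Classical in
/-- The **Metropolis BFACF generator at fugacity `x`**:
`(L g)(γ) = Σ_{γ' : BFACFAdj γ γ'} min(1, x^{|γ'| − |γ|}) · (g γ' − g γ)` — each elementary move is
proposed at rate `1` and accepted with probability `min(1, x^{Δ|γ|})`, the standard reversible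
dynamics for the weights `x^{|γ|}` (Madras–Slade 1993, §9.6.1: BFACF as a variable-length dynamic
Monte Carlo method with fugacity parameter; Metropolis acceptance). A `finsum`, finite for bounded
`Ω` and `δ > 0`. [cite: MadrasSlade1993, §9.6.1 and Lemma 9.6.1] -/
def bfacfGenerator (x : ℝ) (g : DomainSAW Ω δ u v → ℝ) (γ : DomainSAW Ω δ u v) : ℝ :=
  ∑ᶠ γ' : DomainSAW Ω δ u v,
    if DomainSAW.BFACFAdj γ γ' then min 1 (x ^ ((γ'.length : ℤ) - γ.length)) * (g γ' - g γ) else 0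

open Classical in
/-- The **carré du champ** of the BFACF generator:
`Γ(g)(γ) = Σ_{γ' ~ γ} min(1, x^{|γ'| − |γ|}) (g γ' − g γ)²`. [folklore] -/
def bfacfCarreDuChamp (x : ℝ) (g : DomainSAW Ω δ u v → ℝ) (γ : DomainSAW Ω δ u v) : ℝ :=
  ∑ᶠ γ' : DomainSAW Ω δ u v,
    if DomainSAW.BFACFAdj γ γ' then min 1 (x ^ ((γ'.length : ℤ) - γ.length)) * (g γ' - g γ) ^ 2
    else 0

/-- The generator kills constants. [folklore] -/
theorem bfacfGenerator_const (x c : ℝ) (γ : DomainSAW Ω δ u v) :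
    bfacfGenerator x (fun _ => c) γ = 0 := by
  classical
  simp [bfacfGenerator]

/-- The carré du champ is non-negative for `x ≥ 0`. [folklore] -/
theorem bfacfCarreDuChamp_nonneg {x : ℝ} (hx : 0 ≤ x) (g : DomainSAW Ω δ u v → ℝ)
    (γ : DomainSAW Ω δ u v) : 0 ≤ bfacfCarreDuChamp x g γ := by
  classical
  unfold bfacfCarreDuChamp
  refine finsum_nonneg fun γ' => ?_
  split_ifs
  · exact mul_nonneg (le_min zero_le_one (zpow_nonneg hx _)) (sq_nonneg _)
  · exact le_rfl

/-- **Detailed balance for the Metropolis rates** (the identity behind Madras–Slade Lemma 9.6.1: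
the BFACF chain is reversible for the weights `x^{|γ|}`): for `x > 0`,
`x^{|γ|} · min(1, x^{|γ'| − |γ|}) = min(x^{|γ|}, x^{|γ'|})`, an expression symmetric in `γ, γ'`.
[cite: MadrasSlade1993, Lemma 9.6.1] -/
theorem bfacf_detailedBalance {x : ℝ} (hx : 0 < x) (γ γ' : DomainSAW Ω δ u v) :
    x ^ γ.length * min 1 (x ^ ((γ'.length : ℤ) - γ.length)) = min (x ^ γ.length) (x ^ γ'.length) := by
  have hx0 : x ≠ 0 := hx.ne'
  have hpos : 0 ≤ x ^ γ.length := pow_nonneg hx.le _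
  rw [mul_min_of_nonneg _ _ hpos, mul_one]
  congr 1
  rw [← zpow_natCast, ← zpow_natCast, ← zpow_add₀ hx0]
  congr 1
  ring

/-- Detailed balance in symmetric form: `x^{|γ|} min(1, x^{|γ'|−|γ|}) = x^{|γ'|} min(1, x^{|γ|−|γ'|})`.
[cite: MadrasSlade1993, Lemma 9.6.1] -/
theorem bfacf_detailedBalance_symm {x : ℝ} (hx : 0 < x) (γ γ' : DomainSAW Ω δ u v) :
    x ^ γ.length * min 1 (x ^ ((γ'.length : ℤ) - γ.length)) =
      x ^ γ'.length * min 1 (x ^ ((γ.length : ℤ) - γ'.length)) := by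
  rw [bfacf_detailedBalance hx, bfacf_detailedBalance hx, min_comm]

end Literature.Probability.RandomPlanarGeometry.SAW
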